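import Mathlib
import Summits.Ventures.DiscreteObjects.Mahler.CensusCertificateX

/-!
# A faster kernel form of the census search (venture `DiscreteObjects`, target L)

Cell `pub-namedobj`, seat `pub-namedobj-mahler-g19` (pipeline of seats g12–g18). Framing: lottery ticket; floor = certified
bounds/negative ranges.

`censusSearchF T CTs fuel pre ps` enumerates a SUPERSET of the output of the census search `censusSearchC T CT fuel pre ps`
(mahler g13, `CensusSearchCuts`) whenever `densifyTable CTs = CT`, `|ps| = |pre| ≥ 1` (`mem_censusSearchF_of_mem`), and is
3–5× cheaper for the Lean kernel (`decide` with kernel reduction), by three devices that do not change the mathematics: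

* SPARSE CUT ROWS (`SCut`, `cutBoundsS`): a cut `([λ_k,…,λ_1], N)` is stored as `(λ_k, [(skip, λ)…], trailing zeros, N)` and
  evaluated without multiplying by the zeros (at `B = 20/17` the table is essentially the certified unit cuts `±P_k ≥ -N`,
  whose rows are all zeros but one entry; measured: the Toeplitz/resultant rows bind at < 4 % of the nodes of the degree-26 tree);
* the AFFINE LAST LEVEL (`affWindow`, `newtonNext_palC_snoc`): below a node of depth `d-1` the power sum `P_{d+1}` of the leaf
  with last coefficient `c_d` is `U + V·c_d` (`V = d·c_1 - P_1`), so the leaf test `|P_{d+1}| ≤ T_{d+1}` is a window on `c_d`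
  intersected BEFORE the leaves are built (63 % of the 4.63 M degree-26 leaves fail exactly this test), and the surviving leaves
  start their lazy test at `P_{d+2}`;
* a FUSED LEAF TEST (`leafPassF`, `dotAcc`): one pass per Newton step, carrying `k` and the coefficient tail instead of
  recomputing `length`/`getD`.

Soundness is inherited: every statement `∀ a ∈ censusSearchC …, Q a` follows from the same statement for `censusSearchF`
(`forall_mem_censusSearchC_of_F`), so the kernel checks of a census (`allCertifiedX … (censusSearchF …) certs = true` by `decide`)
feed the unchanged verdict `degreeCensus_of_certified_nonnegXC`.  Infrastructure only (no census row is claimed here);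
CONTROL/replication pipeline for the degree-26 row at the Lehmer bound.
-/

namespace Summit.Ventures.DiscreteObjects.Mahler

open Polynomial

/-! ## Sparse cut rows -/

/-- Sparse dot product with accumulator: `sp` lists `(skip, λ)` pairs, consumed against `ps`. -/
def sdot : List (ℕ × ℤ) → List ℤ → ℤ → ℤ
  | [], _, acc => acc
  | (s, l) :: r, ps, acc =>
    match ps.drop s with
    | [] => acc
    | p :: ps' => sdot r ps' (acc + l * p)

/-- The dense coefficient list of a sparse one. -/
def densify : List (ℕ × ℤ) → List ℤ
  | [] => []
  | (s, l) :: r => List.replicate s 0 ++ l :: densify r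

/-- A sparse cut: leading coefficient `λ_k`, sparse `[λ_{k-1},…]`, number of trailing zeros of the dense form, constant `N`. -/
abbrev SCut := ℤ × List (ℕ × ℤ) × ℕ × ℤ

/-- The dense cut `([λ_k,…,λ_1], N)` of a sparse cut. -/
def densifyCut (c : SCut) : List ℤ × ℤ := (c.1 :: (densify c.2.1 ++ List.replicate c.2.2.1 0), c.2.2.2)

/-- The dense cut table of a sparse one. -/
def densifyTable (CTs : List (List SCut)) : List (List (List ℤ × ℤ)) := CTs.map fun row => row.map densifyCut

/-- `cutBounds` on sparse rows. -/
def cutBoundsS : List SCut → List ℤ → ℤ → ℤ → ℤ × ℤ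
  | [], _, lb, ub => (lb, ub)
  | (lk, sp, _, N) :: cs, ps, lb, ub =>
    if 0 < lk then cutBoundsS cs ps (max lb (-(sdot sp ps N / lk))) ub
    else if lk < 0 then cutBoundsS cs ps lb (min ub (sdot sp ps N / (-lk)))
    else cutBoundsS cs ps lb ub

/-- Leading zeros skip entries of the other factor. -/
theorem sum_zipWith_replicate_zero_append (L : List ℤ) : ∀ (s : ℕ) (ps : List ℤ),
    (List.zipWith (· * ·) (List.replicate s 0 ++ L) ps).sum = (List.zipWith (· * ·) L (ps.drop s)).sum := by
  intro s
  induction s with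
  | zero => intro ps; simp
  | succ s ih =>
    intro ps
    cases ps with
    | nil => simp
    | cons p ps => simp [List.replicate_succ, ih ps]

/-- Trailing zeros do not contribute. -/
theorem sum_zipWith_append_replicate_zero : ∀ (L : List ℤ) (m : ℕ) (ps : List ℤ),
    (List.zipWith (· * ·) (L ++ List.replicate m 0) ps).sum = (List.zipWith (· * ·) L ps).sum := by
  intro L
  induction L with
  | nil =>
    intro m ps
    simp only [List.nil_append, List.zipWith_nil_left, List.sum_nil]
    induction m generalizing ps with
    | zero => simp
    | succ m ih => cases ps with
      | nil => simp
      | cons p ps => simp [List.replicate_succ, ih ps]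
  | cons a L ih =>
    intro m ps
    cases ps with
    | nil => simp
    | cons p ps => simp [ih m ps]

/-- The sparse dot product computes the dense one. -/
theorem sdot_eq : ∀ (sp : List (ℕ × ℤ)) (ps : List ℤ) (acc : ℤ),
    sdot sp ps acc = acc + (List.zipWith (· * ·) (densify sp) ps).sum := by
  intro sp
  induction sp with
  | nil => intro ps acc; simp [sdot, densify]
  | cons c r ih =>
    intro ps acc
    obtain ⟨s, l⟩ := c
    rw [densify, sum_zipWith_replicate_zero_append, sdot]
    cases h : ps.drop s with
    | nil => simp
    | cons p ps' => simp [ih ps', add_assoc]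

/-- `cutBoundsS` computes `cutBounds` of the densified rows. -/
theorem cutBoundsS_eq : ∀ (cs : List SCut) (ps : List ℤ) (lb ub : ℤ),
    cutBoundsS cs ps lb ub = cutBounds (cs.map densifyCut) ps lb ub := by
  intro cs
  induction cs with
  | nil => intro ps lb ub; rfl
  | cons c cs ih =>
    intro ps lb ub
    obtain ⟨lk, sp, tz, N⟩ := c
    have hA : sdot sp ps N = N + (List.zipWith (· * ·) (densify sp ++ List.replicate tz 0) ps).sum := by
      rw [sdot_eq, sum_zipWith_append_replicate_zero]
    simp only [cutBoundsS, List.map_cons, densifyCut, cutBounds]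
    split_ifs <;> simp [ih, hA]

/-- Rows of the densified table. -/
theorem getD_densifyTable (CTs : List (List SCut)) (n : ℕ) :
    (densifyTable CTs).getD n [] = (CTs.getD n []).map densifyCut := by
  induction CTs generalizing n with
  | nil => simp [densifyTable]
  | cons row CTs ih =>
    cases n with
    | zero => simp [densifyTable]
    | succ n => simp only [densifyTable, List.map_cons, List.getD_cons_succ]; exact ih n

/-! ## Fused leaf test -/

/-- Dot product with accumulator (one pass). -/
def dotAcc : List ℤ → List ℤ → ℤ → ℤ
  | a :: as, b :: bs, acc => dotAcc as bs (acc + a * b)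
  | _, _, acc => acc

/-- `dotAcc` computes the `zipWith` sum. -/
theorem dotAcc_eq : ∀ (as bs : List ℤ) (acc : ℤ), dotAcc as bs acc = acc + (List.zipWith (· * ·) as bs).sum := by
  intro as
  induction as with
  | nil => intro bs acc; cases bs <;> simp [dotAcc]
  | cons a as ih =>
    intro bs acc
    cases bs with
    | nil => simp [dotAcc]
    | cons b bs => rw [dotAcc, ih]; simp [add_assoc]

/-- Lazy leaf test, fused: `ct = cs.drop (k-1)` (head `c_k`), `k` the index of the next power sum (as an integer). -/
def leafPassF (cs : List ℤ) : List ℤ → ℤ → List ℕ → List ℤ → Bool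
  | _, _, [], _ => true
  | ct, k, t :: ts, ps =>
    let p := -(k * ct.getD 0 0) - dotAcc cs ps 0
    decide (p.natAbs ≤ t) && leafPassF cs ct.tail (k + 1) ts (p :: ps)

/-- The fused Newton step is `newtonNext`. -/
theorem newtonStepF_eq (cs ps : List ℤ) :
    -((((ps.length : ℕ) : ℤ) + 1) * (cs.drop ps.length).getD 0 0) - dotAcc cs ps 0 = newtonNext cs ps := by
  rw [newtonNext, dotAcc_eq, zero_add, List.getD_eq_getElem?_getD, List.getElem?_drop, add_zero,
    ← List.getD_eq_getElem?_getD]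
  push_cast; ring

/-- The fused leaf test is `leafPass`. -/
theorem leafPassF_eq (cs : List ℤ) : ∀ (ts : List ℕ) (ps : List ℤ),
    leafPassF cs (cs.drop ps.length) (((ps.length : ℕ) : ℤ) + 1) ts ps = leafPass cs ts ps := by
  intro ts
  induction ts with
  | nil => intro ps; rfl
  | cons t ts ih =>
    intro ps
    rw [leafPassF, leafPass]
    rw [newtonStepF_eq, List.tail_drop]
    have h := ih (newtonNext cs ps :: ps)
    rw [List.length_cons] at h
    push_cast at h
    rw [h]

/-! ## The affine last level -/

/-- The window of `ak ∈ [lo, hi]` with `|U + V·ak| ≤ t` (exact for `V ≠ 0`; all or nothing for `V = 0`). -/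
def affWindow (U V t lo hi : ℤ) : ℤ × ℤ :=
  if 0 < V then (max lo (-((t + U) / V)), min hi ((t - U) / V))
  else if V < 0 then (max lo (-((t - U) / (-V))), min hi ((t + U) / (-V)))
  else if t < U ∨ U < -t then (1, 0) else (lo, hi)

/-- The window contains every admissible `ak`. -/
theorem affWindow_spec (U V lo hi ak : ℤ) (t : ℕ) (h : (U + V * ak).natAbs ≤ t) (hlo : lo ≤ ak) (hhi : ak ≤ hi) :
    (affWindow U V t lo hi).1 ≤ ak ∧ ak ≤ (affWindow U V t lo hi).2 := by
  have h' : |U + V * ak| ≤ (t : ℤ) := by rw [Int.abs_eq_natAbs]; exact_mod_cast h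
  obtain ⟨h1, h2⟩ := abs_le.mp h'
  unfold affWindow
  split_ifs with hV hV' hU
  · refine ⟨max_le hlo ?_, le_min hhi ?_⟩
    · rw [neg_le, Int.le_ediv_iff_mul_le hV]; linarith
    · rw [Int.le_ediv_iff_mul_le hV]; linarith
  · have hV2 : 0 < -V := by omega
    refine ⟨max_le hlo ?_, le_min hhi ?_⟩
    · rw [neg_le, Int.le_ediv_iff_mul_le hV2]; nlinarith
    · rw [Int.le_ediv_iff_mul_le hV2]; nlinarith
  · exfalso
    have hV0 : V = 0 := by omega
    subst hV0
    simp only [zero_mul, add_zero] at h1 h2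
    omega
  · exact ⟨hlo, hhi⟩

/-- `zipWith` against a list one longer than the prefix picks up exactly one entry of the tail. -/
theorem sum_zipWith_append_cons (rest : List ℤ) (ak : ℤ) : ∀ (pre qs : List ℤ), qs.length = pre.length + 1 →
    (List.zipWith (· * ·) (pre ++ ak :: rest) qs).sum = (List.zipWith (· * ·) pre qs).sum + ak * qs.getD pre.length 0 := by
  intro pre
  induction pre with
  | nil =>
    intro qs hq
    obtain ⟨q, rfl⟩ := List.length_eq_one_iff.mp hq
    simp
  | cons c pre ih =>
    intro qs hq
    cases qs with
    | nil => simp at hq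
    | cons q qs =>
      simp only [List.cons_append, List.zipWith_cons_cons, List.sum_cons, List.length_cons, List.getD_cons_succ]
      rw [ih qs (by simpa using hq)]
      ring

/-- `palC` of a vector with a distinguished last entry. -/
theorem palC_append_single (pre : List ℤ) (ak : ℤ) : palC (pre ++ [ak]) = pre ++ ak :: (pre.reverse ++ [1]) := by
  simp [palC]

/-- **The power sum `P_{d+1}` below a node of depth `d-1` is affine in the last coefficient**: for `|ps| = |pre| = n ≥ 1`,
`newtonNext (palC (pre ++ [ak])) (p :: ps) = -((n+2)·c_n) - (c_1·p + Σ_{i≥2} c_i ps_{i-2} + ak·ps_{n-1})`. -/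
theorem newtonNext_palC_snoc (pre ps : List ℤ) (ak p : ℤ) (hlen : ps.length = pre.length) (h1 : 1 ≤ pre.length) :
    newtonNext (palC (pre ++ [ak])) (p :: ps) =
      -((((pre.length : ℕ) : ℤ) + 2) * pre.getD (pre.length - 1) 0)
        - (pre.getD 0 0 * p + (List.zipWith (· * ·) (pre.drop 1) ps).sum + ak * ps.getD (pre.length - 1) 0) := by
  rw [palC_append_single, newtonNext]
  have hL : (p :: ps).length = pre.length + 1 := by simp [hlen]
  rw [hL, sum_zipWith_append_cons _ _ _ _ hL]
  -- the leading coefficient `c_{n+1}` of the palindromic list is `pre_{n-1}`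
  have hget : (pre ++ ak :: (pre.reverse ++ [1])).getD (pre.length + 1) 0 = pre.getD (pre.length - 1) 0 := by
    rw [List.getD_append_right _ _ _ _ (by omega), show pre.length + 1 - pre.length = 1 by omega, List.getD_cons_succ,
      List.getD_append _ _ _ _ (by simp; omega), List.getD_eq_getElem?_getD, List.getElem?_reverse (by omega),
      ← List.getD_eq_getElem?_getD, show pre.length - 1 - 0 = pre.length - 1 by omega]
  rw [hget]
  obtain ⟨c, pre', rfl⟩ : ∃ c pre', pre = c :: pre' := by
    cases pre with
    | nil => simp at h1
    | cons c pre' => exact ⟨c, pre', rfl⟩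
  simp only [List.zipWith_cons_cons, List.sum_cons, List.getD_cons_zero, List.drop_one, List.tail_cons,
    List.length_cons]
  rw [show c :: pre' = [c] ++ pre' from rfl] at hlen
  have hn : (p :: ps).getD (pre'.length + 1) 0 = ps.getD (pre'.length + 1 - 1) 0 := by
    rw [List.getD_cons_succ]; simp
  rw [hn]
  push_cast
  ring

/-! ## The search -/

/-- **The fast census search** (same tree as `censusSearchC` with `CT = densifyTable CTs`; sparse rows, affine last level,
fused leaf test). -/
def censusSearchF (T : List ℕ) (CTs : List (List SCut)) : ℕ → List ℤ → List ℤ → List (List ℤ)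
  | 0, pre, ps =>
    let n := pre.length
    let cs := palC pre
    if leafPassF cs (cs.drop n) (((n : ℕ) : ℤ) + 1) (T.drop n) ps then [pre] else []
  | fuel + 1, pre, ps =>
    let n := pre.length
    let R : ℤ := -(dotAcc pre ps 0)
    let kz : ℤ := ((n + 1 : ℕ) : ℤ)
    let Tk : ℤ := ((T.getD n 0 : ℕ) : ℤ)
    let b := cutBoundsS (CTs.getD n []) ps (-Tk) Tk
    let lo := -((b.2 - R) / kz)
    let hi := (R - b.1) / kz
    if fuel = 0 then
      match T.drop (n + 1) with
      | [] => (icc lo hi).flatMap fun ak => censusSearchF T CTs fuel (pre ++ [ak]) ((-(kz * ak) + R) :: ps)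
      | t :: ts =>
        let U : ℤ := -((kz + 1) * pre.getD (n - 1) 0) - pre.getD 0 0 * R - dotAcc (pre.drop 1) ps 0
        let V : ℤ := kz * pre.getD 0 0 - ps.getD (n - 1) 0
        let w := affWindow U V t lo hi
        (icc w.1 w.2).flatMap fun ak =>
          let cs := palC (pre ++ [ak])
          if leafPassF cs (cs.drop (n + 2)) (kz + 2) ts ((U + V * ak) :: (-(kz * ak) + R) :: ps) then [pre ++ [ak]]
          else []
    else (icc lo hi).flatMap fun ak => censusSearchF T CTs fuel (pre ++ [ak]) ((-(kz * ak) + R) :: ps)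

/-- The range ends of `censusSearchF` are those of `censusSearchC` (`nodeLoC`, `nodeHiC`). -/
theorem rangeF_eq {T : List ℕ} {CT : List (List (List ℤ × ℤ))} {CTs : List (List SCut)} (hCT : densifyTable CTs = CT)
    (pre ps : List ℤ) :
    -(((cutBoundsS (CTs.getD pre.length []) ps (-((T.getD pre.length 0 : ℕ) : ℤ)) ((T.getD pre.length 0 : ℕ) : ℤ)).2 -
        -(dotAcc pre ps 0)) / ((pre.length + 1 : ℕ) : ℤ)) = nodeLoC T CT pre ps ∧
    (-(dotAcc pre ps 0) -
        (cutBoundsS (CTs.getD pre.length []) ps (-((T.getD pre.length 0 : ℕ) : ℤ)) ((T.getD pre.length 0 : ℕ) : ℤ)).1) /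
        ((pre.length + 1 : ℕ) : ℤ) = nodeHiC T CT pre ps := by
  rw [nodeLoC, nodeHiC, ← hCT, getD_densifyTable, cutBoundsS_eq, dotAcc_eq, zero_add]
  exact ⟨rfl, rfl⟩

/-- **`censusSearchF` outputs a superset of `censusSearchC`** (for `densifyTable CTs = CT`, `|ps| = |pre| ≥ 1`). -/
theorem mem_censusSearchF_of_mem {T : List ℕ} {CT : List (List (List ℤ × ℤ))} {CTs : List (List SCut)}
    (hCT : densifyTable CTs = CT) : ∀ (fuel : ℕ) (pre ps a : List ℤ), ps.length = pre.length → 1 ≤ pre.length →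
      a ∈ censusSearchC T CT fuel pre ps → a ∈ censusSearchF T CTs fuel pre ps := by
  intro fuel
  induction fuel with
  | zero =>
    intro pre ps a hlen _ ha
    rw [censusSearchC] at ha
    rw [censusSearchF]
    rw [← hlen, leafPassF_eq, hlen]
    exact ha
  | succ fuel ih =>
    intro pre ps a hlen h1 ha
    rw [mem_censusSearchC_succ_iff] at ha
    obtain ⟨ak, hak, ha⟩ := ha
    rw [mem_icc] at hak
    obtain ⟨hlo, hhi⟩ := hak
    obtain ⟨hloF, hhiF⟩ := rangeF_eq (T := T) hCT pre ps
    have hlen' : (nodeP pre ps ak :: ps).length = (pre ++ [ak]).length := by simp [hlen]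
    have h1' : 1 ≤ (pre ++ [ak]).length := by simp
    have hP : nodeP pre ps ak = -((((pre.length + 1 : ℕ) : ℤ)) * ak) + -(dotAcc pre ps 0) := by
      rw [nodeP, dotAcc_eq, zero_add]
    rw [censusSearchF]
    dsimp only
    split_ifs with hf
    · subst hf
      cases hT : T.drop (pre.length + 1) with
      | nil =>
        simp only [List.mem_flatMap, mem_icc]
        refine ⟨ak, ⟨by rw [hloF]; exact hlo, by rw [hhiF]; exact hhi⟩, ?_⟩
        rw [← hP]
        exact ih _ _ _ hlen' h1' ha
      | cons t ts =>
        -- the child's leaf test, first step isolated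
        rw [censusSearchC] at ha
        simp only [List.length_append, List.length_singleton, hT] at ha
        split_ifs at ha with hleaf
        · simp only [List.mem_singleton] at ha
          subst ha
          rw [leafPass, Bool.and_eq_true, decide_eq_true_eq] at hleaf
          obtain ⟨h14, hrest⟩ := hleaf
          have hid := newtonNext_palC_snoc pre ps ak (nodeP pre ps ak) hlen h1
          set U : ℤ := -(((((pre.length + 1 : ℕ)) : ℤ) + 1) * pre.getD (pre.length - 1) 0) -
              pre.getD 0 0 * -(dotAcc pre ps 0) - dotAcc (pre.drop 1) ps 0 with hU
          set V : ℤ := (((pre.length + 1 : ℕ)) : ℤ) * pre.getD 0 0 - ps.getD (pre.length - 1) 0 with hV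
          have hUV : newtonNext (palC (pre ++ [ak])) (nodeP pre ps ak :: ps) = U + V * ak := by
            rw [hid, hU, hV, hP, dotAcc_eq, dotAcc_eq, zero_add, zero_add]; push_cast; ring
          rw [hUV] at h14 hrest
          simp only [List.mem_flatMap, mem_icc]
          refine ⟨ak, affWindow_spec U V _ _ ak t h14 (by rw [hloF]; exact hlo) (by rw [hhiF]; exact hhi), ?_⟩
          have hF : leafPassF (palC (pre ++ [ak])) ((palC (pre ++ [ak])).drop (pre.length + 2))
              ((((pre.length + 1 : ℕ)) : ℤ) + 2) ts ((U + V * ak) :: nodeP pre ps ak :: ps) = true := by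
            have := leafPassF_eq (palC (pre ++ [ak])) ts ((U + V * ak) :: nodeP pre ps ak :: ps)
            simp only [List.length_cons, hlen] at this
            rw [show pre.length + 1 + 1 = pre.length + 2 from rfl] at this
            have e : ((((pre.length + 1 : ℕ)) : ℤ) + 2) = (((pre.length + 2 : ℕ) : ℤ) + 1) := by push_cast; ring
            rw [e, this]
            exact hrest
          rw [← hP]
          simp only [hF, if_true, List.mem_singleton]
        · simp at ha
    · simp only [List.mem_flatMap, mem_icc]
      refine ⟨ak, ⟨by rw [hloF]; exact hlo, by rw [hhiF]; exact hhi⟩, ?_⟩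
      rw [← hP]
      exact ih _ _ _ hlen' h1' ha

/-- **Transfer**: a property of every survivor of the fast search holds for every survivor of the census search. -/
theorem forall_mem_censusSearchC_of_F {T : List ℕ} {CT : List (List (List ℤ × ℤ))} {CTs : List (List SCut)}
    (hCT : densifyTable CTs = CT) {fuel : ℕ} {pre ps : List ℤ} (hlen : ps.length = pre.length) (h1 : 1 ≤ pre.length)
    {Q : List ℤ → Prop} (hF : ∀ a ∈ censusSearchF T CTs fuel pre ps, Q a) :
    ∀ a ∈ censusSearchC T CT fuel pre ps, Q a :=
  fun a ha => hF a (mem_censusSearchF_of_mem hCT fuel pre ps a hlen h1 ha)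

/-- **Kernel-check form**: certificates for the fast search's survivors certify the census search's survivors. -/
theorem forall_certX_of_allCertifiedF {Bn Bd d : ℕ} {L : List (List ℤ)} {LC : List (List ℤ × ℤ)} {T : List ℕ}
    {CT : List (List (List ℤ × ℤ))} {CTs : List (List SCut)} (hCT : densifyTable CTs = CT) {fuel : ℕ} {pre ps : List ℤ}
    (hlen : ps.length = pre.length) (h1 : 1 ≤ pre.length) (certs : List CertX)
    (h : allCertifiedX Bn Bd d L LC (censusSearchF T CTs fuel pre ps) certs = true) :
    ∀ a ∈ censusSearchC T CT fuel pre ps, ∃ c, checkCertX Bn Bd d L LC (1 :: palC a) c = true :=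
  forall_mem_censusSearchC_of_F hCT hlen h1 (exists_certX_of_allCertifiedX _ certs h)

end Summit.Ventures.DiscreteObjects.Mahler
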